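import Summits.Ventures.CertifiedArithmetic.LowPrec.DoubleRoundingThresholdWitness

/-!
# Double rounding of products — products inherit the sum witness (THEOREM D-dm, a footnote)

HONEST FRAMING: certified error envelopes and provably optimal rounding/accumulation schemes for
low-precision formats under stated cost models; every table by two implementations; no hardware
or vendor claims.

The necessity half of clause (T) of THEOREM D-dr (`DoubleRoundingThresholdWitness.lean`) is a
statement about a VALUE, not about sums: for formats `φ ⊆ ψ` with `P_φ < P_ψ ≤ P_φ + k`
(`k ≥ 2`) the rational `x = (2^(P_φ+k) + 2^k + 1) · quantum φ` is double rounded wrongly —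
`fl_ψ` moves it onto the midpoint `2^(P_φ+k) + 2^k` of `φ`, whose tie resolves downwards, while
`fl_φ x` is the upper neighbour (`roundNE_roundNE_ne_above_midpoint`).  For sums the value is
realised as `2^(P_φ+k) + (2^k + 1)`; for PRODUCTS it is realised whenever the odd
number `2^(P_φ+k) + 2^k + 1` factors into two significands of `φ` — e.g. `2^9 + 2^4 + 1 = 529
= 23²` for `P_φ = 5`, `k = 4`: binary8p5 products formed in bfloat16 (`P_ψ = 8 ≤ 9`) fail at
`23/16 · 23/8 = 529/128 ↦ 33/8 ↦ 4`, direct `17/4` (`not_drMul_Binary8p5_BFloat16_sq`).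

* `not_drMul_of_midpoint_witness` — for EVERY pair of format records: the hypotheses of
  `roundNE_roundNE_ne_above_midpoint` plus two `φ`-data `a`, `b` with `a · b = x` refute
  `∀ a b, fl_φ (fl_ψ (a·b)) = fl_φ (a·b)`.

With unbounded exponents the strip `P_φ < P_ψ < 2 P_φ` fails for products exactly when
`P_φ ≥ 4` (implementation A, `DOUBLE-ROUNDING-MUL.md` §4b: the square of `3·2^(P-2) - 1` is one
unit above a general midpoint `(2t+1)·2^(P-1)`; brute force `P ≤ 8`); the present file covers the
special midpoints above a power of two only.  Implementation A: `code/enum/doublemul_decision.py`.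
References: [Figueroa1995] §3; [Roux2014] Table II; [Rump2016] Lemma 4.4 (the sum witness).
-/

namespace Summit.Ventures.CertifiedArithmetic

open Literature.ComputerArithmetic.FloatingPoint
open Literature.ComputerArithmetic.FloatingPoint.Format
open Literature.ComputerArithmetic.FloatingPoint.MiniFloat

/-- PRODUCTS INHERIT THE SUM WITNESS — for every pair of format records: if
`quantum ψ ∣ quantum φ` (`hq`), the range of `φ` maps into `ψ` (`hM`), `2 ≤ P_φ`,
`P_φ < P_ψ ≤ P_φ + k` with `k ≥ 2`, the two neighbours `2^(P_φ+k)` and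
`2^(P_φ+k) + 2^(k+1)` of the midpoint are values of `φ` (`hu`), and two `φ`-data `a`, `b`
have the product `(2^(P_φ+k) + 2^k + 1) · quantum φ`, then double rounding of products
through `ψ` fails at `(a, b)`. -/
theorem not_drMul_of_midpoint_witness {φ ψ : Format} (hq : ψ.qexp ≤ φ.qexp)
    (hM : φ.maxScaled * 2 ^ (φ.qexp - ψ.qexp).toNat ≤ ψ.maxScaled) (h1 : 1 ≤ φ.manBits)
    (hP : φ.manBits < ψ.manBits) {k : ℕ} (hk : 2 ≤ k) (hk' : ψ.manBits ≤ φ.manBits + k)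
    (hu : 2 ^ (φ.manBits + 1 + k) + 2 ^ (k + 1) ≤ φ.maxScaled) (a b : MiniFloat φ)
    (hab : a.toRat * b.toRat
      = ((2 ^ (φ.manBits + 1 + k) + 2 ^ k + 1 : ℕ) : ℚ) * φ.quantum) :
    ¬ ∀ a b : MiniFloat φ, (roundNE φ (roundNE ψ (a.toRat * b.toRat)).toRat).toRat
      = (roundNE φ (a.toRat * b.toRat)).toRat := by
  intro h
  have hab' := h a b
  rw [hab] at hab'
  exact roundNE_roundNE_ne_above_midpoint hq hM h1 hP hk hk' hu hab'

/-- THE INSTANCE binary8p5 → bfloat16 (`P_φ = 5`, `P_ψ = 8`, `k = 4`): `2^9 + 2^4 + 1 = 529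
= 23²`, `a = 23/16`, `b = 23/8`; the product `529/128` is rounded by bfloat16 to the binary8p5
midpoint `33/8` and then down to `4`, against `fl_binary8p5 (529/128) = 17/4`.  (The cell's
first failing pair, in `DoubleRoundingProductCells.lean`, is a different one: `9/128 · 31/16`.) -/
theorem not_drMul_Binary8p5_BFloat16_sq :
    ¬ ∀ a b : MiniFloat Binary8p5,
      (roundNE Binary8p5 (roundNE BFloat16 (a.toRat * b.toRat)).toRat).toRat
        = (roundNE Binary8p5 (a.toRat * b.toRat)).toRat :=
  not_drMul_of_midpoint_witness (φ := Binary8p5) (ψ := BFloat16) (k := 4) (by decide)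
    (by decide +kernel) (by decide) (by decide) (by decide) (by decide) (by decide +kernel)
    ⟨false, 4, 7, by decide, by decide, by decide⟩
    ⟨false, 5, 7, by decide, by decide, by decide⟩ (by decide +kernel)

/-- The same value as a SUM and as a PRODUCT of binary8p5 data: `4 + 17/128 = 23/16 · 23/8 =
529/128`; both operations are double rounded wrongly through bfloat16 at these operands
(`roundNE_roundNE_ne_above_midpoint` with `k = 4`; clause (T) of D-dr uses `k = 3` here). -/
theorem sum_eq_product_witness_Binary8p5 :
    (⟨false, 6, 0, by decide, by decide, by decide⟩ : MiniFloat Binary8p5).toRat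
        + (⟨false, 1, 1, by decide, by decide, by decide⟩ : MiniFloat Binary8p5).toRat
      = (⟨false, 4, 7, by decide, by decide, by decide⟩ : MiniFloat Binary8p5).toRat
        * (⟨false, 5, 7, by decide, by decide, by decide⟩ : MiniFloat Binary8p5).toRat ∧
    (⟨false, 4, 7, by decide, by decide, by decide⟩ : MiniFloat Binary8p5).toRat
        * (⟨false, 5, 7, by decide, by decide, by decide⟩ : MiniFloat Binary8p5).toRat
      = 529 / 128 := by
  constructor <;> decide +kernel

end Summit.Ventures.CertifiedArithmetic
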